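import Literature.ModelTheory.PseudofiniteFields.DefinableSetsFiniteFieldsDecomposition
import Literature.ModelTheory.PseudofiniteFields.DefinableSetsFiniteFieldsToolkit
import HarnessLib

/-!
# CDM Prop. (2.7): the normal form as polynomials over a pseudo-finite field

Topic `Literature/ModelTheory/PseudofiniteFields`.  The principal (pseudo-finite) clause of
Chatzidakis–van den Dries–Macintyre 1992, Prop. (2.7) — the named fact
`ChatzidakisVanDenDriesMacintyre1992_prop27` of `DefinableSetsFiniteFieldsDecomposition.lean` —
says that a ring formula `φ(X)`, `X = (X_1, …, X_m)`, is equivalent, uniformly in all enriched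
pseudo-finite fields `(K, c)`, to a conjunction `⋀_l ∃T g_l(c, X, T) = 0` with RING TERMS
`g_l ∈ ℤ[C, X, T]`.  Here we derive its SEMANTIC form inside one pseudo-finite field `K` (an
infinite model of `finiteFieldTheory`) for a formula with set variables `Fin m` and parameter
variables `Fin n` evaluated at `y ∈ Kⁿ`:

* `ChatzidakisVanDenDriesMacintyre1992_prop27.exists_polynomial_normalForm` — there are finitely
  many polynomials `G_l ∈ K[X_1, …, X_m][S]` with
  `φ(x, y) ↔ ⋀_l (G_l(x, S) has a root in K)` for all `x ∈ K^m`;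

together with the two ingredients, both unconditional:

* `exists_enrichment_of_model_finiteFieldTheory` — a pseudo-finite field carries enrichments
  of every depth `B` (CDM (2.6): constants `c_{k,i}`, `k < B`, the coefficients of an
  irreducible monic polynomial of degree `k + 2`; from
  `exists_monic_irreducible_of_model_finiteFieldTheory`, i.e. CDM (2.5); the finite-field
  counterpart is `exists_enrichment` of `DefinableSetsFiniteFieldsProofs.lean`);
* `exists_polynomial_realize_eq`, `exists_polynomial_realize_eq_finSum` — a ring term in
  variables `(constants ⊕ (set variables ⊕ parameters)) ⊕ {T}`, with the constants and the
  parameters evaluated in `K`, is a polynomial `G ∈ K[X][S]`: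
  `G(x, s) = g(c, x, y, s)` (substitute `C (C c_i)`, `C (X_a)`, `C (C y_b)`, `S` and use that term
  realisation commutes with the ring homomorphism `G ↦ G(x, s)`, `map_realize_term`).

Nothing here is a definition or a named fact; the only printed input is the hypothesis `h27`.

## References

* Z. Chatzidakis, L. van den Dries, A. Macintyre, *Definable sets over finite fields*, J. reine
  angew. Math. 427 (1992) 107–135: (2.5), (2.6), Prop. (2.7) (pp. 116–118).
  [ChatzidakisVanDenDriesMacintyre1992]
* J. Ax, *The elementary theory of finite fields*, Ann. of Math. 88 (1968) 239–271, §§7–8.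
  [Ax1968]
-/

namespace Literature.ModelTheory.PseudofiniteFields

open FirstOrder FirstOrder.Language FirstOrder.Ring
open scoped Polynomial

/-! ### Enrichments exist in every pseudo-finite field -/

/-- **Enrichments of every depth exist in a pseudo-finite field** (CDM (2.6): for each
`n = k + 2 ≤ B + 1` constants `c_{n,0}, …, c_{n,n-1}` such that
`T^n + c_{n,n-1} T^{n-1} + ⋯ + c_{n,0}` is irreducible; they exist because a pseudo-finite field
has an irreducible monic polynomial of every positive degree, (2.5)).  Rendering: the
coefficient presentation `X^(k+2) + Σ_i C (c ⟨k, i⟩) X^i` of the hypothesis of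
`ChatzidakisVanDenDriesMacintyre1992_prop27`.
[cite: ChatzidakisVanDenDriesMacintyre1992, (2.5)–(2.6)] -/
theorem exists_enrichment_of_model_finiteFieldTheory (K : Type) [Field K] [CompatibleRing K]
    [Infinite K] (hK : K ⊨ finiteFieldTheory) (B : ℕ) :
    ∃ c : (Σ k : Fin B, Fin (k.1 + 2)) → K,
      ∀ k : Fin B, Irreducible (Polynomial.X ^ (k.1 + 2) +
        ∑ i : Fin (k.1 + 2), Polynomial.C (c ⟨k, i⟩) * Polynomial.X ^ (i : ℕ)) := by
  have hμ : ∀ k : Fin B, ∃ μ : K[X], μ.Monic ∧ Irreducible μ ∧ μ.natDegree = k.1 + 2 :=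
    fun k => exists_monic_irreducible_of_model_finiteFieldTheory K hK (Nat.succ_pos _)
  choose μ hμm hμi hμd using hμ
  refine ⟨fun ki => (μ ki.1).coeff ki.2, fun k => ?_⟩
  rw [X_pow_add_sum_coeff_eq (hμm k) (hμd k)]
  exact hμi k

/-! ### Ring terms with constants and parameters evaluated are polynomials in `K[X][S]` -/

/-- **A ring term is a polynomial over the field of constants.**  For a ring term `t` in the
variables `(ε ⊕ (α ⊕ β)) ⊕ Fin 1` — constants `ε`, set variables `α`, parameters `β`, one bound
variable — and values `c : ε → K`, `y : β → K` in a commutative ring `K`, there is a polynomial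
`G ∈ K[X_α][S]` with `G(x, s) = t(c, x, y, s)` for all `x`, `s` (here `G(x, s)` is
`(G.map (MvPolynomial.eval x)).eval s`).  Proof: realise `t` in the ring `K[X_α][S]` at
`(C (C c), C X, C (C y), S)` and push the evaluation homomorphism through (`map_realize_term`).
[folklore] -/
theorem exists_polynomial_realize_eq {K : Type*} [CommRing K] [CompatibleRing K]
    {ε α β : Type*} (t : Language.ring.Term ((ε ⊕ (α ⊕ β)) ⊕ Fin 1)) (c : ε → K) (y : β → K) :
    ∃ G : Polynomial (MvPolynomial α K), ∀ (x : α → K) (s : K),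
      (G.map (MvPolynomial.eval x)).eval s =
        t.realize (Sum.elim (Sum.elim c (Sum.elim x y)) fun _ => s) := by
  letI : CompatibleRing (Polynomial (MvPolynomial α K)) := compatibleRingOfRing _
  refine ⟨t.realize (Sum.elim (Sum.elim (fun i => Polynomial.C (MvPolynomial.C (c i)))
      (Sum.elim (fun a => Polynomial.C (MvPolynomial.X a))
        (fun b => Polynomial.C (MvPolynomial.C (y b))))) fun _ => Polynomial.X),
    fun x s => ?_⟩
  rw [Polynomial.eval_map, ← Polynomial.coe_eval₂RingHom, map_realize_term]
  congr 1
  funext v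
  rcases v with (i | a | b) | o <;> simp

/-- The same with the set variables and the parameters merged into one block `Fin (m + n)` along
`finSumFinEquiv` (the variable convention of `ChatzidakisVanDenDriesMacintyre1992_prop27`, whose
formulas have free variables `Fin m`): for a ring term `t` in the variables
`(ε ⊕ Fin (m + n)) ⊕ Fin 1` there is `G ∈ K[X_1, …, X_m][S]` with
`G(x, s) = t(c, (x, y), s)`. [folklore] -/
theorem exists_polynomial_realize_eq_finSum {K : Type*} [CommRing K] [CompatibleRing K]
    {ε : Type*} {m n : ℕ} (t : Language.ring.Term ((ε ⊕ Fin (m + n)) ⊕ Fin 1)) (c : ε → K)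
    (y : Fin n → K) :
    ∃ G : Polynomial (MvPolynomial (Fin m) K), ∀ (x : Fin m → K) (s : K),
      (G.map (MvPolynomial.eval x)).eval s =
        t.realize (Sum.elim (Sum.elim c (Sum.elim x y ∘ finSumFinEquiv.symm)) fun _ => s) := by
  obtain ⟨G, hG⟩ := exists_polynomial_realize_eq
    (t.relabel (Sum.map (Sum.map id finSumFinEquiv.symm) id)) c y
  refine ⟨G, fun x s => ?_⟩
  rw [hG, Term.realize_relabel]
  simp only [Sum.elim_comp_map, Function.comp_id]

/-! ### The normal form of Prop. (2.7) as polynomials over `K` -/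

/-- **CDM Prop. (2.7), semantic normal form over a pseudo-finite field.**  Assume the principal
clause of Chatzidakis–van den Dries–Macintyre 1992, Prop. (2.7) (`h27`).  Then for every ring
formula `φ` with set variables `Fin m` and parameter variables `Fin n`, every pseudo-finite field
`K` (an infinite model of the theory of finite fields) and every `y ∈ Kⁿ` there are finitely
many polynomials `G_1, …, G_L ∈ K[X_1, …, X_m][S]` such that for all `x ∈ K^m`:
`φ(x, y) ↔ ⋀_l ∃ s ∈ K, G_l(x, s) = 0` — the definable set `φ(K^m; y)` is a finite intersection
of projections of hypersurfaces `{G_l(x, s) = 0} ⊆ K^m × K`.  Proof: merge the variables into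
`Fin (m + n)`, apply (2.7) to get terms `g_l(C, X, T) ∈ ℤ[C, X, T]`, choose an enrichment `c` of
`K` of the required depth (`exists_enrichment_of_model_finiteFieldTheory`, CDM (2.6)), and
substitute `c` and `y` (`exists_polynomial_realize_eq_finSum`).
[cite: ChatzidakisVanDenDriesMacintyre1992, Prop. (2.7) and (2.6)] -/
theorem ChatzidakisVanDenDriesMacintyre1992_prop27.exists_polynomial_normalForm
    (h27 : ChatzidakisVanDenDriesMacintyre1992_prop27) {m n : ℕ}
    (φ : Language.ring.Formula (Fin m ⊕ Fin n)) (K : Type) [Field K] [CompatibleRing K]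
    [Infinite K] (hK : K ⊨ finiteFieldTheory) (y : Fin n → K) :
    ∃ (L : ℕ) (G : Fin L → Polynomial (MvPolynomial (Fin m) K)),
      ∀ x : Fin m → K, φ.Realize (Sum.elim x y) ↔
        ∀ l, ∃ s : K, ((G l).map (MvPolynomial.eval x)).eval s = 0 := by
  obtain ⟨B, L, g, hg⟩ := h27 (m + n) (φ.relabel finSumFinEquiv)
  obtain ⟨c, hc⟩ := exists_enrichment_of_model_finiteFieldTheory K hK B
  choose G hG using fun l => exists_polynomial_realize_eq_finSum (g l) c y
  refine ⟨L, G, fun x => ?_⟩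
  have hφ : φ.Realize (Sum.elim x y) ↔
      (φ.relabel finSumFinEquiv).Realize (Sum.elim x y ∘ finSumFinEquiv.symm) := by
    rw [Formula.realize_relabel, Function.comp_assoc, Equiv.symm_comp_self, Function.comp_id]
  rw [hφ, hg K hK c hc]
  refine forall_congr' fun l => exists_congr fun s => ?_
  rw [hG l]

end Literature.ModelTheory.PseudofiniteFields
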